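import Summits.HodgeConjecture.HodgeConjecture.Theorems.F0P2oCharIdentityCompletionUniqueTest   -- ★ p840326 (F0P2-p06 (g5)): the NAME-FREE dock core `thetaTypeAtCM_of_charIdentityAtTest_of_witness`
import Literature.NumberTheory.Rogawski1990.CharIdentityOnTestFunctionsFormSign               -- (B1′) F0P2-p06 (g14): `clauseSign_eq_intCast_formSignAt`, `isLocalDeltaTransferExists_constMul_formSignAt_iff` (⟸ ★ B1 p848284)
import Literature.NumberTheory.GelbartRogawski1991.PiSCompletionIsThetaTypeTestSignedW1      -- ROAD W (b) LH10-plan (g0): `piSCompletion_isThetaTypeAtCMTestSignedW1` ((D-b)ᵀˢ on the weight-one automorphic locus)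
import Literature.NumberTheory.Rogawski1990.CMThetaDockingClausesTestW1                       -- ROAD W (a): `CMThetaDockingClausesTestW1`
import HarnessLib

/-!
# Crux `H413`, programme P2 — THE DOCKᵀ JUNCTION ON THE WEIGHT-ONE AUTOMORPHIC LOCUS («W1»), SIGN-TRANSPORTED:
# `CMThetaDockingClausesTestW1` at print's factor `Δ° := v ↦ (Δ v).constMul ↑(formSignAt L c H v)` ⟸ (D-b)ᵀˢ-W1 at the factor of record `Δ` + G-surjective matching

Cell `hodgecm-mathlib` (D-0151), FLOOR 0, crux item H413 = `stmt-HodgeConjecture-24833`, route of record `HCCMUnconditional`; programme P2.  ROAD W of the LH10 line (LH10-p02 (g0)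
2026-09-02T03:19:42Z; F0P2-p06 (g14) census 03:24:26Z; F0P2-ref1 (g10) r363 (2)–(3), r364 (3) item (d) «junction twin»).  Seat F0P2-p06 (g14).  Helper file: THEOREMS ONLY (no
definition, no named fact, no instance declaration or attribute, no notation, no `sorry`); `--supports stmt-HodgeConjecture-24833 --as helper`; Lines-free.  HONEST LABEL: HC_CM is
proved only modulo the printed citations (2 remaining named inputs hLiu418 24832, h413 24833) until rung 0 closes; this file discharges none of them — it is the W1 twin of ★
`cmThetaDockingClausesTest_of_thetaWitness` (ED. 2) composed with the B1 sign transport.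

WHAT.  The W1 letters carry two extra hypotheses `HasWeight L μ 1 →` `IsAutomorphicOneChar (↥(maximalRealSubfield L)) L (IsCMField.complexConj L) χf →` after the unit-norm
hypothesis (ROAD W (a) `CMThetaDockingClausesTestW1`, (b) `piSCompletion_isThetaTypeAtCMTestSignedW1`).  The junction is POINTWISE in the binder tuple (the name-free core ★
`thetaTypeAtCM_of_charIdentityAtTest_of_witness` serves ONE tuple), so the W1 twin is the ED. 2 proof with the two hypotheses threaded from the DOCK-W1 binders into the
(D-b)-W1 witness; and since the Day-X record carries the SIGNED letter at the factor of record `Δ` (= `Δ‴`) while the dock is stated with UNSIGNED member traces, the junction is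
stated at print's factor `Δ° := fun v => (Δ v).constMul ↑(formSignAt L c H v)`: the signed witness at `Δ_v` IS an unsigned witness at `Δ°_v` (★ `LocalAPacket.charIdentityAtTest_constMul_iff`
+ ★ `clauseSign_eq_intCast_formSignAt`), and G-surjective matching transports along `Δ ↦ Δ°` (★ `isLocalDeltaTransferExists_constMul_formSignAt_iff`).

* **`cmThetaDockingClausesTestW1_constMul_formSignAt_of_thetaWitnessSignedW1`** — `(hex : H₇ at Δ, non-split v) (hWS : piSCompletion_isThetaTypeAtCMTestSignedW1 L H Δ mH mG νH νG ξ μω ξloc e₁ dV hdV hdV0 g hg)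
  ⊢ CMThetaDockingClausesTestW1 L H (fun v => (Δ v).constMul ↑(formSignAt L c H v)) mH mG νH νG ξ μω ξloc e₁ dV hdV hdV0 g hg`.

References: [Rogawski1990] §13.1 Prop. 13.1.3 (d), Prop. 13.1.4 p. 199; §4.9 Prop. 4.9.1 (a) p. 55; §14.6 p. 242.  [GelbartRogawski1991] Lem. 5.1.2 p. 466; Thm. 5.1.1 p. 465.
[Liu2021] Def. 4.11, Prop. 4.13.  [LanglandsShelstad1987] §1.
-/

set_option autoImplicit false
-- the mandated namespace repeats `HodgeConjecture.HodgeConjecture`, as in every `Theorems/*.lean` of this sub-problem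
set_option linter.dupNamespace false

noncomputable section

open NumberField IsDedekindDomain MeasureTheory
open scoped Matrix

open Literature.NumberTheory Literature.NumberTheory.Automorphic Literature.NumberTheory.Automorphic.UnitaryGroup
open Literature.NumberTheory.Automorphic.IdeleClassGroup
open Literature.NumberTheory.Automorphic.Liu2021 Literature.NumberTheory.Automorphic.Liu2021.Def411WeilCarriers
open Literature.NumberTheory.GaloisRepresentations
open Literature.NumberTheory.Rogawski1990
open Literature.NumberTheory.GelbartRogawski1991

namespace Summit.HodgeConjecture.HodgeConjecture.Cruxes.H413.F0P2oCharIdentityCompletionUniqueTestW1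

open Summit.HodgeConjecture.HodgeConjecture.Cruxes.H413.F0P2oCharIdentityCompletionUniqueTest (thetaTypeAtCM_of_charIdentityAtTest_of_witness)

set_option synthInstance.maxHeartbeats 400000 in
set_option maxHeartbeats 8000000 in
open scoped Classical in
/-- **DOCKᵀ-W1 AT PRINT'S FACTOR `Δ°` ⟸ (D-b)ᵀˢ-W1 AT THE FACTOR OF RECORD `Δ` + G-surjective matching on `C_c^∞` at `Δ`.**  For global data `(Δ, m_H, m_G, ν_H, ν_G, ξloc)` with
`ν_G v` Haar and (H₇) at every non-split `v`, at a hermitian `H` with unit determinant and a rational theta frame: IF for every W1 binder tuple SOME class `πθ` completing `πⁿ ∘ e`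
in the SIGNED Test identity at `Δ_v` is a theta type (the body of (D-b)ᵀˢ-W1 `piSCompletion_isThetaTypeAtCMTestSignedW1`, BY NAME), THEN the W1 theta-docking clause holds at
`Δ° := fun v => (Δ v).constMul ↑(formSignAt L c H v)`: every supercuspidal `πs ≠ πⁿ ∘ e` completing `πⁿ ∘ e` in the UNSIGNED Test identity at `Δ°_v` IS that `πθ`, hence a theta
type.  Pointwise the ED. 2 proof ★ `thetaTypeAtCM_of_charIdentityAtTest_of_witness` at `Δ°`, fed (H₇) transported along `Δ ↦ Δ°` and the signed witness read as an unsigned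
witness at `Δ°` (B1).  Print's dock [Rogawski1990 Prop. 13.1.3 (d), 13.1.4; GelbartRogawski1991 Lem. 5.1.2] RESTRICTED to the weight-one automorphic locus — the only locus
HC_CM instantiates (★ `pkPi_of_tokens` :208–:221 ∕ skeleton :936).
[cite: Rogawski1990, §13.1 Prop. 13.1.3 (d), Prop. 13.1.4 p. 199; §4.9 Prop. 4.9.1 (a) p. 55; §14.6 p. 242] [cite: GelbartRogawski1991, Lem. 5.1.2 p. 466] [cite: Liu2021, Def. 4.11, Prop. 4.13] -/
theorem cmThetaDockingClausesTestW1_constMul_formSignAt_of_thetaWitnessSignedW1 (L : Type) [Field L] [NumberField L] [IsCMField L] (H : Matrix (Fin 3) (Fin 3) L)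
    (hH : (H.map (cmConjRingHom L))ᵀ = H) (hHd : IsUnit H.det)
    [∀ v : HeightOneSpectrum (𝓞 ↥(maximalRealSubfield L)), MeasurableSpace ((cmDatum L 3 H).Local v)]
    [∀ v : HeightOneSpectrum (𝓞 ↥(maximalRealSubfield L)), BorelSpace ((cmDatum L 3 H).Local v)]
    [∀ v : HeightOneSpectrum (𝓞 ↥(maximalRealSubfield L)),
      MeasurableSpace ((cmDatum L 2 (Matrix.of fun i j : Fin 2 => if i.val + j.val + 1 = 2 then (1 : L) else 0)).Local v ×
        (cmDatum L 1 (Matrix.of fun i j : Fin 1 => if i.val + j.val + 1 = 1 then (1 : L) else 0)).Local v)]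
    [∀ (v : HeightOneSpectrum (𝓞 ↥(maximalRealSubfield L)))
        (a : ((cmDatum L 2 (Matrix.of fun i j : Fin 2 => if i.val + j.val + 1 = 2 then (1 : L) else 0)).Local v ×
          (cmDatum L 1 (Matrix.of fun i j : Fin 1 => if i.val + j.val + 1 = 1 then (1 : L) else 0)).Local v)),
      MeasurableSpace (((cmDatum L 2 (Matrix.of fun i j : Fin 2 => if i.val + j.val + 1 = 2 then (1 : L) else 0)).Local v ×
          (cmDatum L 1 (Matrix.of fun i j : Fin 1 => if i.val + j.val + 1 = 1 then (1 : L) else 0)).Local v) ⧸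
        Subgroup.centralizer ({a} : Set ((cmDatum L 2 (Matrix.of fun i j : Fin 2 => if i.val + j.val + 1 = 2 then (1 : L) else 0)).Local v ×
          (cmDatum L 1 (Matrix.of fun i j : Fin 1 => if i.val + j.val + 1 = 1 then (1 : L) else 0)).Local v)))]
    [∀ (v : HeightOneSpectrum (𝓞 ↥(maximalRealSubfield L))) (γ : (cmDatum L 3 H).Local v),
      MeasurableSpace ((cmDatum L 3 H).Local v ⧸ Subgroup.centralizer ({γ} : Set ((cmDatum L 3 H).Local v)))]
    (Δ : ∀ v : HeightOneSpectrum (𝓞 ↥(maximalRealSubfield L)), LocalTransferFactor L H v)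
    (mH : ∀ v : HeightOneSpectrum (𝓞 ↥(maximalRealSubfield L)),
      OrbitalMeasureFamily ((cmDatum L 2 (Matrix.of fun i j : Fin 2 => if i.val + j.val + 1 = 2 then (1 : L) else 0)).Local v ×
        (cmDatum L 1 (Matrix.of fun i j : Fin 1 => if i.val + j.val + 1 = 1 then (1 : L) else 0)).Local v))
    (mG : ∀ v : HeightOneSpectrum (𝓞 ↥(maximalRealSubfield L)), OrbitalMeasureFamily ((cmDatum L 3 H).Local v))
    (νH : ∀ v : HeightOneSpectrum (𝓞 ↥(maximalRealSubfield L)),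
      Measure ((cmDatum L 2 (Matrix.of fun i j : Fin 2 => if i.val + j.val + 1 = 2 then (1 : L) else 0)).Local v ×
        (cmDatum L 1 (Matrix.of fun i j : Fin 1 => if i.val + j.val + 1 = 1 then (1 : L) else 0)).Local v))
    (νG : ∀ v : HeightOneSpectrum (𝓞 ↥(maximalRealSubfield L)), Measure ((cmDatum L 3 H).Local v))
    [∀ v : HeightOneSpectrum (𝓞 ↥(maximalRealSubfield L)), (νG v).IsHaarMeasure]
    (ξ : OneDimAutRepH L) (μω : HeckeCharacter L)
    (ξloc : ∀ v : HeightOneSpectrum (𝓞 ↥(maximalRealSubfield L)),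
      (cmDatum L 2 (Matrix.of fun i j : Fin 2 => if i.val + j.val + 1 = 2 then (1 : L) else 0)).Local v ×
        (cmDatum L 1 (Matrix.of fun i j : Fin 1 => if i.val + j.val + 1 = 1 then (1 : L) else 0)).Local v →* ℂˣ)
    {n' : ℕ} (e₁ : Fin 3 × Fin 1 ≃ Fin n') (dV : Fin 3 → L) (hdV : ∀ i, IsCMField.complexConj L (dV i) = dV i) (hdV0 : ∀ i, dV i ≠ 0) (g : GL (Fin 3) L)
    (hg : ((g : Matrix (Fin 3) (Fin 3) L).map (cmConjRingHom L))ᵀ * H * (g : Matrix (Fin 3) (Fin 3) L) = Matrix.diagonal dV)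
    -- (H₇) G-surjective matching on `C_c^∞` at every non-split finite place, AT THE FACTOR OF RECORD `Δ`
    (hex : ∀ v : HeightOneSpectrum (𝓞 ↥(maximalRealSubfield L)), (∀ w : PlacesOver L v, IsCMField.complexConj L • w.1 = w.1) →
      IsLocalDeltaTransferExists L H v (Δ v) (mH v) (mG v) IsLocSmooth IsLocSmooth)
    -- the theta WITNESS on test functions, SIGNED, on the weight-one automorphic locus = letter (D-b)ᵀˢ-W1 BY NAME, AT `Δ`
    (hWS : piSCompletion_isThetaTypeAtCMTestSignedW1 L H Δ mH mG νH νG ξ μω ξloc e₁ dV hdV hdV0 g hg) :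
    CMThetaDockingClausesTestW1 L H (fun v => (Δ v).constMul ((formSignAt L (IsCMField.complexConj L) H v : ℤ) : ℂ)) mH mG νH νG ξ μω ξloc e₁ dV hdV hdV0 g hg := by
  intro μ hμ χf hcont hunit hw haut hdμ hdχ v hns T a ha h _ _ μZ _ π2 πn hK hn πs _hsc _hne hId
  obtain ⟨ε, πθ, hCI, hθ⟩ := hWS μ hμ χf hcont hunit hw haut hdμ hdχ v hns T a ha h μZ π2 πn hK hn
  have hsign : ((formSignAt L (IsCMField.complexConj L) H v : ℤ) : ℂ) * ((formSignAt L (IsCMField.complexConj L) H v : ℤ) : ℂ) = 1 :=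
    intCast_formSignAt_mul_self L H v
  -- the SIGNED witness at `Δ_v` is an UNSIGNED witness at `Δ°_v`
  have hCI' : (⟨IrrClass.comap (cmDatumLocalCongr L v T ha h).symm πn, some πθ⟩ : CMLocalAPacket L H v).CharIdentityAtTest L H v
      (fun c f => c.smoothTrace (νG v) f) (ξloc v) (νH v) ((Δ v).constMul ((formSignAt L (IsCMField.complexConj L) H v : ℤ) : ℂ)) (mH v) (mG v) := by
    rw [LocalAPacket.charIdentityAtTest_constMul_iff L H v _ (fun c f => c.smoothTrace (νG v) f) (ξloc v) (νH v) (Δ v) (mH v) (mG v) hsign,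
      ← clauseSign_eq_intCast_formSignAt L H hH v hns T a ha h]
    exact hCI
  exact thetaTypeAtCM_of_charIdentityAtTest_of_witness L H hH hHd (fun v => (Δ v).constMul ((formSignAt L (IsCMField.complexConj L) H v : ℤ) : ℂ)) mH mG νH νG
    ξloc e₁ dV hdV hdV0 g hg μ hμ χf v ((isLocalDeltaTransferExists_constMul_formSignAt_iff L H v (Δ v) (mH v) (mG v)).2 (hex v hns)) T a ha h πn
    ⟨ε, πθ, hCI', hθ⟩ πs hId

end Summit.HodgeConjecture.HodgeConjecture.Cruxes.H413.F0P2oCharIdentityCompletionUniqueTestW1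

end
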